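import Summits.BirchSwinnertonDyer.Rank1Residual.Additive.X4ExoticWild
import Summits.BirchSwinnertonDyer.Rank1Residual.AdditivePotMult.PStarTwistModel
import Summits.BirchSwinnertonDyer.Rank1Residual.Additive.RamifiedTwistKodairaSymbol
import Literature.NumberTheory.EllipticCurves.OggFormulaWildTypesKodairaProofs
import Literature.NumberTheory.EllipticCurves.VariableChangeApproxProofs
import Literature.NumberTheory.EllipticCurves.RootNumberTwistProofs
import Literature.NumberTheory.DiophantineGeometry.TateAlgorithmTameTypesOddProofs
import HarnessLib

/-!
# Kodaira types at `3` versus the conductor exponent: the WILD types `II, IV, IV*, II*` have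
# `ord₃ Δ_min ≥ m + 2` (`f₃ ≥ 3`), the TAME types `Iₙ*, III, III*` have `f₃ = 2`, and
# `ord₃ j < 0 ⟹ Iₙ*` (`n ≥ 1`) (cell `b2b-bsdres`, team n1011, seat p14 gen 2 — sequel of row T-b9
# `Additive/X4ExoticWild.lean`; part 1 of the census ↔ Kodaira dictionary at `3`)

HONEST FRAMING (cell `b2b-bsdres`, run/shared/lean/b2b/bsd-rank1-residual/, verbatim in every
file): the goal of the cell is to DELETE the COMBINATION-SHAPED residual classes of the
Birch–Swinnerton-Dyer formula for ALL analytic-rank `≤ 1` elliptic curves over `ℚ` — "full BSD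
formula for every rank `≤ 1` curve in class `C`" assembled STRICTLY from published theorems — so
that the rank-`≤ 1` remainder becomes exactly the CONSTRUCTION-SHAPED classes, which are TYPED
(missing-input `Prop`s), NOT attempted. This is not "finishing BSD". Team n1011 (N10 / N11, the
additive block X4 ∧ `p = 3`): research route; no claim beyond the stated classes; labels UNCHANGED;
nothing is booked. Theorems only (no definition, no named fact).

## What this file proves

For `W/ℚ` elliptic, `K₃ := W.kodairaSymbolAt (placeOf 3)` (Tate's algorithm at the place `(3)` of
`ℤ`), `condExp W 3 = f₃` the tree's conductor exponent (DEFINED by Ogg's formula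
`f = ord Δ_min + 1 − m`, `DiophantineGeometry/Conductor.lean`):

* §1 `le_ord_Δ_of_valuation_b_placeOf_three` — valuation bookkeeping: `ord₃ b₂ ≥ k₂`, `ord₃ b₄ ≥ k₄`,
  `ord₃ b₆ ≥ k₆` ⟹ `ord₃ Δ ≥ N` whenever `N ≤ 3k₂+k₆, 2k₂+2k₄, 3k₄, 3+2k₆, 2+k₂+k₄+k₆`, from
  `4Δ = −b₂²(b₂b₆ − b₄²) − 32b₄³ − 4·3³·b₆² + 4·3²·b₂b₄b₆`;
  **`numComponents_add_two_le_ordMinimalDiscriminant_three_of_kodairaSymbolAt_wild`** — the WILD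
  types `II, IV, IV*, II*` at `3` have `ord₃ Δ_min ≥ m + 2` (Tate's normal form
  `exists_variableChange_b_of_kodairaSymbolAt_wild` with `(k₂,k₄,k₆) = (1,1,1), (1,2,2), (2,3,4),
  (2,4,5)`, made `ℚ`-rational by `exists_variableChange_valuation_of_adicCompletion`); hence
  **`three_le_condExp_three_of_kodairaSymbolAt_wild`** (`f₃ ≥ 3`, i.e. `27 ∣ N`) and
  `not_condExpTwo_three_of_kodairaSymbolAt_wild`; the TAME types have `f₃ = 2`
  (`condExpTwo_three_of_kodairaSymbolAt_tame`, the tree's `conductorExponent_eq_two_of_kodairaSymbolAt`).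
* §2 `exists_kodairaSymbolAt_eq_Istar_succ_of_potMult_three` — additive with `ord₃ j < 0` ⟹
  `K₃ = Iₙ*`, `n ≥ 1` (twist model `AdditivePotMult.PotMult.exists_mult_pStar_twist_model` +
  additive-p4's `kodairaSymbolAt_twist_of_semistable`; `n = 0` excluded since `I₀*` is type (G));
  `potMult_three_iff_kodairaSymbolAt_Istar_succ`.

The Table-4.1 rows `v(Δ) = 2, 4, 8, 10` of `II, IV, IV*, II*` thus never occur at `p = 3`: these
types are WILD there, the others tame (A. Kraus, Manuscripta Math. 69 (1990): `3 ∣ #Φ` exactly on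
`II, IV, IV*, II*`).  Sequel: `Additive/KodairaDictionaryThree.lean` (census cells ↔ Kodaira types,
row T-b9 in census currency).  Nothing booked; no label change.

References: [SilvermanATAEC1994] III.1, IV.9.4 (Tate's algorithm), Table 4.1, IV.10–11 (Ogg's
formula at `p = 3`, PDF pp. 365–371); A. Kraus, Manuscripta Math. 69 (1990) 353–385.
-/

noncomputable section

open scoped Classical NumberField

open WeierstrassCurve IsDedekindDomain IsDedekindDomain.HeightOneSpectrum NumberField WithZero
  Rat.HeightOneSpectrum Literature.NumberTheory.EllipticCurves
  Literature.NumberTheory.EllipticCurves.ModularForms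
  Literature.NumberTheory.EllipticCurves.Rank1Residual
  Literature.NumberTheory.EllipticCurves.Rank1Residual.Typed
  Literature.NumberTheory.DiophantineGeometry
  Summit.BirchSwinnertonDyer.Rank1Residual.GaloisImage
  Summit.BirchSwinnertonDyer.Rank1Residual.AdditivePotMult

namespace Summit.BirchSwinnertonDyer.Rank1Residual.Additive

/-! ### §1 Wild types at `3`: `ord₃ Δ_min ≥ m + 2`, so `f₃ ≥ 3`; tame types: `f₃ = 2` -/

section Wild

/-- The rational prime below `placeOf 3` is `3`. [folklore] -/
private theorem natGenerator_placeOf_three' : natGenerator (placeOf 3) = 3 :=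
  Literature.NumberTheory.EllipticCurves.Rat.natGenerator_primesEquiv_symm ⟨3, Nat.prime_three⟩

/-- `ord_{(3)}(3) = 1`: the valuation of `3` at the place `(3)` of `ℤ` is `exp (-1)`. [folklore] -/
private theorem valuation_placeOf_three_three :
    (placeOf 3).valuation ℚ (3 : ℚ) = exp (-1 : ℤ) := by
  rw [Rat.HeightOneSpectrum.valuation_eq_exp_neg_padicValRat (placeOf 3) three_ne_zero,
    natGenerator_placeOf_three', show (3 : ℚ) = ((3 : ℕ) : ℚ) by norm_num,
    padicValRat.self (by norm_num)]

/-- `ord_{(3)}(n) ≥ 0` for a natural number `n`. [folklore] -/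
private theorem valuation_placeOf_three_natCast_le_one (n : ℕ) :
    (placeOf 3).valuation ℚ (n : ℚ) ≤ 1 := by
  rw [← map_natCast (algebraMap ℤ ℚ) n]
  exact valuation_le_one _ _

/-- **Valuation bookkeeping for the wild bound.**  If a Weierstrass equation `Y/ℚ` has
`ord₃ b₂ ≥ k₂`, `ord₃ b₄ ≥ k₄`, `ord₃ b₆ ≥ k₆`, `ord₃ Δ = e`, and `N ≤ 3k₂ + k₆`, `N ≤ 2k₂ + 2k₄`,
`N ≤ 3k₄`, `N ≤ 3 + 2k₆`, `N ≤ 2 + k₂ + k₄ + k₆`, then `N ≤ e` — from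
`4Δ = −b₂²(b₂b₆ − b₄²) − 32b₄³ − 4·27·b₆² + 4·9·b₂b₄b₆` and the ultrametric inequality at the
place `(3)`. [cite: SilvermanATAEC1994, III.1 (b-invariants and Δ) and IV Table 4.1] -/
theorem le_ord_Δ_of_valuation_b_placeOf_three (Y : WeierstrassCurve ℚ) {k₂ k₄ k₆ e N : ℕ}
    (hb₂ : (placeOf 3).valuation ℚ Y.b₂ ≤ exp (-(k₂ : ℤ)))
    (hb₄ : (placeOf 3).valuation ℚ Y.b₄ ≤ exp (-(k₄ : ℤ)))
    (hb₆ : (placeOf 3).valuation ℚ Y.b₆ ≤ exp (-(k₆ : ℤ)))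
    (hΔ : (placeOf 3).valuation ℚ Y.Δ = exp (-(e : ℤ)))
    (h₁ : N ≤ 3 * k₂ + k₆) (h₂ : N ≤ 2 * k₂ + 2 * k₄) (h₃ : N ≤ 3 * k₄) (h₄ : N ≤ 3 + 2 * k₆)
    (h₅ : N ≤ 2 + k₂ + k₄ + k₆) : N ≤ e := by
  set w := (placeOf 3).valuation ℚ with hw
  have h3 : w 3 = exp (-1 : ℤ) := valuation_placeOf_three_three
  have h4 : w 4 = 1 := by
    rw [Rat.HeightOneSpectrum.valuation_eq_exp_neg_padicValRat (placeOf 3) four_ne_zero,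
      natGenerator_placeOf_three']
    have : padicValRat 3 (4 : ℚ) = 0 := by
      rw [show (4 : ℚ) = ((4 : ℕ) : ℚ) by norm_num, padicValRat.of_nat]
      norm_num [padicValNat.eq_zero_of_not_dvd]
    rw [this]; rfl
  have h32 : w 32 ≤ 1 := by exact_mod_cast valuation_placeOf_three_natCast_le_one 32
  -- the identity
  have hrel := Y.b_relation
  have hid : 4 * Y.Δ = -(Y.b₂ ^ 2 * (Y.b₂ * Y.b₆ - Y.b₄ ^ 2)) - 32 * Y.b₄ ^ 3
      - 4 * 3 ^ 3 * Y.b₆ ^ 2 + 4 * 3 ^ 2 * (Y.b₂ * Y.b₄ * Y.b₆) := by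
    simp only [WeierstrassCurve.Δ]
    linear_combination (-(Y.b₂ ^ 2)) * hrel
  -- term bounds
  have hpow : ∀ {x : ℚ} {k : ℕ}, w x ≤ exp (-(k : ℤ)) → ∀ j : ℕ, w (x ^ j) ≤ exp (-((j * k : ℕ) : ℤ)) := by
    intro x k hx j
    rw [map_pow, show (-((j * k : ℕ) : ℤ)) = j • (-(k : ℤ)) by push_cast; ring, exp_nsmul]
    exact pow_le_pow_left' hx j
  have hmul : ∀ {x y : ℚ} {a b : ℤᵐ⁰}, w x ≤ a → w y ≤ b → w (x * y) ≤ a * b :=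
    fun hx hy ↦ by rw [map_mul]; exact mul_le_mul' hx hy
  -- T1 = b₂² (b₂ b₆ - b₄²)
  have hT1 : w (Y.b₂ ^ 2 * (Y.b₂ * Y.b₆ - Y.b₄ ^ 2)) ≤ exp (-(N : ℤ)) := by
    have ha : w (Y.b₂ * Y.b₆) ≤ exp (-((k₂ + k₆ : ℕ) : ℤ)) := by
      refine (hmul hb₂ hb₆).trans_eq ?_
      rw [← exp_add]; push_cast; ring_nf
    have hb : w (Y.b₄ ^ 2) ≤ exp (-((2 * k₄ : ℕ) : ℤ)) := hpow hb₄ 2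
    have hsub : w (Y.b₂ * Y.b₆ - Y.b₄ ^ 2) ≤
        max (exp (-((k₂ + k₆ : ℕ) : ℤ))) (exp (-((2 * k₄ : ℕ) : ℤ))) :=
      (Valuation.map_sub _ _ _).trans (max_le_max ha hb)
    have hsq : w (Y.b₂ ^ 2) ≤ exp (-((2 * k₂ : ℕ) : ℤ)) := hpow hb₂ 2
    rcases le_max_iff.mp hsub with hs | hs
    · refine (hmul hsq hs).trans ?_
      rw [← exp_add]; exact exp_le_exp.mpr (by push_cast; omega)
    · refine (hmul hsq hs).trans ?_
      rw [← exp_add]; exact exp_le_exp.mpr (by push_cast; omega)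
  -- T2 = 32 b₄³
  have hT2 : w (32 * Y.b₄ ^ 3) ≤ exp (-(N : ℤ)) := by
    refine (hmul h32 (hpow hb₄ 3)).trans ?_
    rw [one_mul]; exact exp_le_exp.mpr (by push_cast; omega)
  -- T3 = 4 · 3³ · b₆²
  have hT3 : w (4 * 3 ^ 3 * Y.b₆ ^ 2) ≤ exp (-(N : ℤ)) := by
    have h33 : w (4 * 3 ^ 3) ≤ exp (-(3 : ℤ)) := by
      rw [map_mul, h4, one_mul, map_pow, h3, ← exp_nsmul]; norm_num
    refine (hmul h33 (hpow hb₆ 2)).trans ?_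
    rw [← exp_add]; exact exp_le_exp.mpr (by push_cast; omega)
  -- T4 = 4 · 3² · b₂ b₄ b₆
  have hT4 : w (4 * 3 ^ 2 * (Y.b₂ * Y.b₄ * Y.b₆)) ≤ exp (-(N : ℤ)) := by
    have h32' : w (4 * 3 ^ 2) ≤ exp (-(2 : ℤ)) := by
      rw [map_mul, h4, one_mul, map_pow, h3, ← exp_nsmul]; norm_num
    have hbbb : w (Y.b₂ * Y.b₄ * Y.b₆) ≤ exp (-((k₂ + k₄ + k₆ : ℕ) : ℤ)) := by
      refine (hmul (hmul hb₂ hb₄) hb₆).trans_eq ?_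
      rw [← exp_add, ← exp_add]; push_cast; ring_nf
    refine (hmul h32' hbbb).trans ?_
    rw [← exp_add]; exact exp_le_exp.mpr (by push_cast; omega)
  -- assemble
  have htot : w (4 * Y.Δ) ≤ exp (-(N : ℤ)) := by
    rw [hid]
    refine (Valuation.map_add _ _ _).trans (max_le ?_ hT4)
    refine (Valuation.map_sub _ _ _).trans (max_le ?_ hT3)
    refine (Valuation.map_sub _ _ _).trans (max_le ?_ hT2)
    rw [Valuation.map_neg]; exact hT1
  rw [map_mul, h4, one_mul, hΔ, exp_le_exp] at htot
  omega

variable (W : WeierstrassCurve ℚ) [W.IsElliptic]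

/-- **The wild Kodaira types at `3` have `ord₃ Δ_min ≥ m + 2`.**  For `W/ℚ` elliptic with Kodaira
symbol `II`, `IV`, `IV*` or `II*` at the place `(3)` of `ℤ` (`m = 1, 3, 7, 9` components):
`m + 2 ≤ ord₃ Δ_min`.  Tate's normal form for the wild types (tree
`exists_variableChange_b_of_kodairaSymbolAt_wild`, *ATAEC* IV.9.4 Steps 3/5/8/10) made
`ℚ`-rational (`exists_variableChange_valuation_of_adicCompletion`) has `ord₃ b₂ ≥ k₂`,
`ord₃ b₄ ≥ k₄`, `ord₃ b₆ ≥ k₆`, `(k₂,k₄,k₆) = (1,1,1), (1,2,2), (2,3,4), (2,4,5)`, and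
`le_ord_Δ_of_valuation_b_placeOf_three` applies with `N = m + 2 = 3, 5, 9, 11`.  (Equivalently: the
Table-4.1 rows `v(Δ) = 2, 4, 8, 10` of the types `II, IV, IV*, II*` never occur at `p = 3`; these
types are WILD there.) [cite: SilvermanATAEC1994, IV.9.4 and Table 4.1 (PDF p. 365); proof of IV.11.1 for p = 3 (PDF pp. 368–371)] -/
theorem numComponents_add_two_le_ordMinimalDiscriminant_three_of_kodairaSymbolAt_wild
    (hT : W.kodairaSymbolAt (placeOf 3) = .II ∨ W.kodairaSymbolAt (placeOf 3) = .IV ∨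
      W.kodairaSymbolAt (placeOf 3) = .IVstar ∨ W.kodairaSymbolAt (placeOf 3) = .IIstar) :
    (W.kodairaSymbolAt (placeOf 3)).numComponents + 2 ≤ W.ordMinimalDiscriminant (placeOf 3) := by
  haveI : PerfectField (IsLocalRing.ResidueField ((placeOf 3).adicCompletionIntegers ℚ)) :=
    PerfectField.ofFinite
  have h2 : ringChar (ℤ ⧸ (placeOf 3).asIdeal) ≠ 2 := by rw [ringChar_int_quot_placeOf 3]; decide
  have hπ := valuation_placeOf_three_three
  -- the four types with their `(k₂, k₄, k₆)` and `m`
  have main : ∀ {k₂ k₄ k₆ : ℕ} (m : ℕ), (W.kodairaSymbolAt (placeOf 3)).numComponents = m →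
      ((W.kodairaSymbolAt (placeOf 3) = .II ∧ k₂ = 1 ∧ k₄ = 1 ∧ k₆ = 1) ∨
        (W.kodairaSymbolAt (placeOf 3) = .IV ∧ k₂ = 1 ∧ k₄ = 2 ∧ k₆ = 2) ∨
        (W.kodairaSymbolAt (placeOf 3) = .IVstar ∧ k₂ = 2 ∧ k₄ = 3 ∧ k₆ = 4) ∨
        (W.kodairaSymbolAt (placeOf 3) = .IIstar ∧ k₂ = 2 ∧ k₄ = 4 ∧ k₆ = 5)) →
      m + 2 ≤ 3 * k₂ + k₆ → m + 2 ≤ 2 * k₂ + 2 * k₄ → m + 2 ≤ 3 * k₄ → m + 2 ≤ 3 + 2 * k₆ →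
      m + 2 ≤ 2 + k₂ + k₄ + k₆ →
      (W.kodairaSymbolAt (placeOf 3)).numComponents + 2 ≤ W.ordMinimalDiscriminant (placeOf 3) := by
    intro k₂ k₄ k₆ m hm hT' i₁ i₂ i₃ i₄ i₅
    obtain ⟨C, β₂, β₄, β₆, δ, hβ₆, hδ, hb₂, hb₄, hb₆, hΔ⟩ :=
      W.exists_variableChange_b_of_kodairaSymbolAt_wild (placeOf 3) h2 hT' hπ
    obtain ⟨C', hb₂', hb₄', hb₆', hΔ'⟩ :=
      W.exists_variableChange_valuation_of_adicCompletion (placeOf 3) C hπ hβ₆ hδ hb₂ hb₄ hb₆ hΔ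
    rw [hm]
    exact le_ord_Δ_of_valuation_b_placeOf_three (C' • W) hb₂' hb₄' hb₆'.le hΔ' i₁ i₂ i₃ i₄ i₅
  rcases hT with h | h | h | h
  · exact main (k₂ := 1) (k₄ := 1) (k₆ := 1) 1 (by rw [h]; rfl) (Or.inl ⟨h, rfl, rfl, rfl⟩)
      (by norm_num) (by norm_num) (by norm_num) (by norm_num) (by norm_num)
  · exact main (k₂ := 1) (k₄ := 2) (k₆ := 2) 3 (by rw [h]; rfl) (Or.inr (Or.inl ⟨h, rfl, rfl, rfl⟩))
      (by norm_num) (by norm_num) (by norm_num) (by norm_num) (by norm_num)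
  · exact main (k₂ := 2) (k₄ := 3) (k₆ := 4) 7 (by rw [h]; rfl)
      (Or.inr (Or.inr (Or.inl ⟨h, rfl, rfl, rfl⟩)))
      (by norm_num) (by norm_num) (by norm_num) (by norm_num) (by norm_num)
  · exact main (k₂ := 2) (k₄ := 4) (k₆ := 5) 9 (by rw [h]; rfl)
      (Or.inr (Or.inr (Or.inr ⟨h, rfl, rfl, rfl⟩)))
      (by norm_num) (by norm_num) (by norm_num) (by norm_num) (by norm_num)

/-- **The wild Kodaira types at `3` have conductor exponent `f₃ ≥ 3`** (`27 ∣ N`): `f = ord Δ_min +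
1 − m` (the tree's definition of `conductorExponent`, Ogg's formula) and §1's `ord Δ_min ≥ m + 2`.
[cite: SilvermanATAEC1994, IV.10.4 and Table 4.1; proof of IV.11.1 for p = 3 (PDF pp. 368–371)] -/
theorem three_le_condExp_three_of_kodairaSymbolAt_wild
    (hT : W.kodairaSymbolAt (placeOf 3) = .II ∨ W.kodairaSymbolAt (placeOf 3) = .IV ∨
      W.kodairaSymbolAt (placeOf 3) = .IVstar ∨ W.kodairaSymbolAt (placeOf 3) = .IIstar) :
    3 ≤ condExp W 3 := by
  have h := numComponents_add_two_le_ordMinimalDiscriminant_three_of_kodairaSymbolAt_wild W hT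
  unfold condExp conductorExponent numComponentsAt
  omega

/-- Wild Kodaira type at `3` ⟹ NOT "tame" in the census sense (`f₃ ≠ 2`).
[cite: SilvermanATAEC1994, IV Table 4.1 (PDF p. 365)] -/
theorem not_condExpTwo_three_of_kodairaSymbolAt_wild
    (hT : W.kodairaSymbolAt (placeOf 3) = .II ∨ W.kodairaSymbolAt (placeOf 3) = .IV ∨
      W.kodairaSymbolAt (placeOf 3) = .IVstar ∨ W.kodairaSymbolAt (placeOf 3) = .IIstar) :
    ¬ CondExpTwo W 3 := by
  have h := three_le_condExp_three_of_kodairaSymbolAt_wild W hT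
  unfold CondExpTwo
  omega

/-- **The tame additive types `Iₙ*` (`n ≥ 0`), `III`, `III*` at `3` have `f₃ = 2`** (the tree's
`conductorExponent_eq_two_of_kodairaSymbolAt`, *ATAEC* Table 4.1 / proof of IV.11.1 p. 367–368, read
at the place `(3)` of `ℤ`). [cite: SilvermanATAEC1994, Table 4.1 and proof of IV.11.1, p = 3 (PDF pp. 367–368)] -/
theorem condExpTwo_three_of_kodairaSymbolAt_tame
    (hT : W.kodairaSymbolAt (placeOf 3) = .III ∨ W.kodairaSymbolAt (placeOf 3) = .IIIstar ∨
      ∃ n, W.kodairaSymbolAt (placeOf 3) = .Istar n) : CondExpTwo W 3 := by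
  haveI : PerfectField (IsLocalRing.ResidueField ((placeOf 3).adicCompletionIntegers ℚ)) :=
    PerfectField.ofFinite
  have h2 : ringChar (ℤ ⧸ (placeOf 3).asIdeal) ≠ 2 := by rw [ringChar_int_quot_placeOf 3]; decide
  exact W.conductorExponent_eq_two_of_kodairaSymbolAt (placeOf 3) h2 hT

end Wild

/-! ### §2 `ord₃ j < 0 ⟹ Iₙ*`, `n ≥ 1` -/

section PotMult

variable (W : WeierstrassCurve ℚ) [W.IsElliptic]

/-- **Potentially multiplicative at `3` ⟹ Kodaira type `Iₙ*`, `n ≥ 1`, at `3`.**  `ord₃ j < 0`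
makes `W` the `(−3)`-twist of a globally minimal `V` multiplicative at `3`
(`AdditivePotMult.PotMult.exists_mult_pStar_twist_model`), so its Kodaira type at the place over `3` is some `Iₙ*`
(additive-p4's `kodairaSymbolAt_twist_of_semistable`, Tate's algorithm Steps 6–7); `n = 0` is
excluded because `I₀*` is type (G) and then `ord₃ j ≥ 0` (`typeG_three_of_kodairaSymbolAt_eq_Istar_zero`,
`padicValRat_j_nonneg_of_typeG`).  Read at `placeOf 3` through
`GaloisImage.kodairaSymbolAt_primesEquiv_symm_three_eq`.
[cite: SilvermanATAEC1994, IV.9.4 Steps 6–7 (PDF pp. 345–346) and Table 4.1] -/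
theorem exists_kodairaSymbolAt_eq_Istar_succ_of_potMult_three [Fact (Nat.Prime 3)] (hadd : Addv W 3)
    (hpm : PotMult W 3) : ∃ n : ℕ, W.kodairaSymbolAt (placeOf 3) = .Istar (n + 1) := by
  obtain ⟨V, iV, iVm, C, hmV, hW⟩ :=
    AdditivePotMult.PotMult.exists_mult_pStar_twist_model (W := W) (p := 3) ⟨hadd, hpm⟩ (by norm_num)
  set u₃ : HeightOneSpectrum (𝓞 ℚ) := (primesEquiv (R := 𝓞 ℚ)).symm ⟨3, Nat.prime_three⟩
    with hu₃def
  have hv3 : (primesEquiv u₃ : ℕ) = 3 := by rw [hu₃def, Equiv.apply_symm_apply]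
  have hv2 : (primesEquiv u₃ : ℕ) ≠ 2 := by rw [hv3]; decide
  -- `V` multiplicative at the place `u₃`
  have hmult : V.HasMultiplicativeReductionAt u₃ := by
    have key := V.hasMultiplicativeReductionAtPrime_iff_hasMultiplicativeReductionAt_ringOfIntegers u₃
    revert key
    generalize primesEquiv u₃ = q at hv3 ⊢
    obtain ⟨q, hq⟩ := q
    cases hv3
    intro key
    exact key.mp hmV
  have hW' : C • V.quadraticTwist ((-3 : ℤ) : ℚ) = W := by
    rw [← hW, pStar_three]; norm_num
  obtain ⟨n, hn⟩ := kodairaSymbolAt_twist_of_semistable u₃ V hv2 (D := -3) (by norm_num)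
    (by rw [hv3]; norm_num) (by rw [hv3]; decide) (Or.inr hmult) C hW'
  have hK : W.kodairaSymbolAt (placeOf 3) = .Istar n := by
    rw [← kodairaSymbolAt_primesEquiv_symm_three_eq (placeOf 3) W
      (Literature.NumberTheory.EllipticCurves.Rat.natGenerator_primesEquiv_symm ⟨3, Nat.prime_three⟩)]
    exact hn
  cases n with
  | zero =>
    exact absurd hpm (not_lt.mpr (padicValRat_j_nonneg_of_typeG W 3
      (typeG_three_of_kodairaSymbolAt_eq_Istar_zero W hK)))
  | succ k => exact ⟨k, hK⟩

/-- **(M) at `3` ⟺ Kodaira `Iₙ*`, `n ≥ 1`** (`PotMult W 3 ↔ ∃ n, K₃ = Iₙ₊₁*`).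
[cite: SilvermanATAEC1994, IV Table 4.1 (PDF p. 365)] -/
theorem potMult_three_iff_kodairaSymbolAt_Istar_succ [Fact (Nat.Prime 3)] (hadd : Addv W 3) :
    PotMult W 3 ↔ ∃ n : ℕ, W.kodairaSymbolAt (placeOf 3) = .Istar (n + 1) :=
  ⟨exists_kodairaSymbolAt_eq_Istar_succ_of_potMult_three W hadd,
    fun ⟨_, h⟩ ↦ padicValRat_j_neg_of_kodairaSymbolAt_eq_Istar_succ W h⟩

end PotMult

end Summit.BirchSwinnertonDyer.Rank1Residual.Additive

end
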